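import Summits.ValiantsHypothesis.ValiantsHypothesis.Theorems.SymPencilPerFourInnerRankPureGramKernel

/-!
# Route `SymPencil` — P1 steps (4)–(5) on the line `ν-Gram = c₀` (class `+++`): block-pattern tools (`4 + 8` form of the kernel-elimination principle)
# (`--supports` stmt-ValiantsHypothesis-5674 `SdcSuperquadratic`; (8,8) column; rung currency only)

Generated by `pub/val-lit/lmr/p8g14-P1/genlean.py` from the exact certificate data
(`L_families.json`, `certchain_ppp.json`; blueprint `BLUEPRINT-Lean.md`).  Setting: a PURE weighted
family `Σ_r c_r t_r(u,y)² = per` (`hJ`, `hX`) whose `ν`-Gram table `⟨n_bk, n_b'k'⟩` is the all-ones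
complementary form `c₀` (`hN`); `z` a coefficient vector in the kernel of the Gram map of the 32
generators `n_bk = t((0,e_b),(e_k,0))`, `m_al = t((e_a,0),(0,e_l))` (`hz`).  Honest framing: lemmas
toward the kernel proof of P1 (pure per₄-designs need 12 squares; paper proof with exact certificates in
`pub/val-lit/lmr/p8g14-P1/`); the cells `(8,8,10)`, `(8,8,11)`, the window `27 ≤ sdc(per_4) ≤ 29`, the
crux `SdcSuperquadratic` and `VP ≠ VNP` are untouched. No definitions, no named facts. [folklore]
-/

noncomputable section

-- single-conjunct layout: Sub = Summit, duplicated namespace component intended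
set_option linter.dupNamespace false
set_option linter.unusedSimpArgs false

namespace Summit.ValiantsHypothesis.ValiantsHypothesis.Theorems.SymPencilPerFourInnerRankPureGramLineTools

open Matrix Finset Module
open Summit.ValiantsHypothesis.ValiantsHypothesis.Theorems.SymPencilPerFourInnerRankRows
open Summit.ValiantsHypothesis.ValiantsHypothesis.Theorems.SymPencilPerFourInnerRankTenFamily
open Summit.ValiantsHypothesis.ValiantsHypothesis.Theorems.SymPencilPerFourInnerRankPureGramCount


variable {K : Type*} [Field K] [CharZero K] {ι : Type*} [Fintype ι]
omit [CharZero K] in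
/-- Block pattern: if the upper-right block vanishes and both diagonal blocks have non-zero
determinant, the determinant is non-zero. [folklore] -/
theorem det_ne_zero_of_blocks {S₁ S₂ : Type*} [Fintype S₁] [Fintype S₂] [DecidableEq S₁]
    [DecidableEq S₂] (M : Matrix (S₁ ⊕ S₂) (S₁ ⊕ S₂) K)
    (h12 : ∀ i j, M (Sum.inl i) (Sum.inr j) = 0) (h11 : M.toBlocks₁₁.det ≠ 0)
    (h22 : M.toBlocks₂₂.det ≠ 0) : M.det ≠ 0 := by
  have hM : M = Matrix.fromBlocks M.toBlocks₁₁ M.toBlocks₁₂ M.toBlocks₂₁ M.toBlocks₂₂ :=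
    (Matrix.fromBlocks_toBlocks M).symm
  have h0 : M.toBlocks₁₂ = 0 := by
    ext i j; exact h12 i j
  rw [hM, h0, Matrix.det_fromBlocks_zero₁₂]
  exact mul_ne_zero h11 h22

omit [CharZero K] in
/-- Evaluation of a functional on a two-point test vector. [folklore] -/
theorem sum_mul_two_single {J : Type*} [Fintype J] [DecidableEq J] (a : J → K) (j₁ j₂ : J)
    (w₁ w₂ : K) :
    ∑ j, a j * (w₁ * (Pi.single j₁ (1 : K) : J → K) j + w₂ * (Pi.single j₂ (1 : K) : J → K) j) =
      w₁ * a j₁ + w₂ * a j₂ := by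
  simp only [mul_add, Finset.sum_add_distrib, Pi.single_apply, mul_ite, mul_one, mul_zero,
    Finset.sum_ite_eq', Finset.mem_univ, if_true]
  ring

omit [CharZero K] in
/-- **`4 + 8` block form of the kernel-elimination principle.**  Four `y`-functionals `aL` and eight
kernel equations `aE`, killing the Gram kernel, with test vectors `vL`, `vE` such that the pairing
matrix is `[[L, 0], [*, 1]]`, `L = [[1, 0], [*, D]]`, `det D ≠ 0`: then `|ι| ≤ 11` is impossible.
[folklore] -/
theorem false_of_kernel_functionals_4_8 [DecidableEq ι] (hι : Fintype.card ι ≤ 11) (c : ι → K)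
    {J : Type*} [Fintype J] [DecidableEq J] (u : J → ι → K) (aL vL : Fin 4 → J → K)
    (aE vE : Fin 8 → J → K)
    (hkillL : ∀ z : J → K, (∀ j' : J, ∑ j, z j * ∑ r, c r * u j r * u j' r = 0) →
      ∀ i, ∑ j, aL i j * z j = 0)
    (hkillE : ∀ z : J → K, (∀ j' : J, ∑ j, z j * ∑ r, c r * u j r * u j' r = 0) →
      ∀ i, ∑ j, aE i j * z j = 0)
    (hLE : ∀ i i', ∑ j, aL i j * vE i' j = 0)
    (hEE : ∀ i i', ∑ j, aE i j * vE i' j = if i = i' then 1 else 0)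
    (h00 : ∑ j, aL 0 j * vL 0 j = 1) (h01 : ∑ j, aL 0 j * vL 1 j = 0)
    (h02 : ∑ j, aL 0 j * vL 2 j = 0) (h03 : ∑ j, aL 0 j * vL 3 j = 0)
    (h10 : ∑ j, aL 1 j * vL 0 j = 0) (h11 : ∑ j, aL 1 j * vL 1 j = 1)
    (h12 : ∑ j, aL 1 j * vL 2 j = 0) (h13 : ∑ j, aL 1 j * vL 3 j = 0)
    (hD : (∑ j, aL 2 j * vL 2 j) * (∑ j, aL 3 j * vL 3 j) -
      (∑ j, aL 2 j * vL 3 j) * (∑ j, aL 3 j * vL 2 j) ≠ 0) : False := by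
  -- index the twelve functionals by (Fin 2 ⊕ Fin 2) ⊕ Fin 8
  let a : (Fin 2 ⊕ Fin 2) ⊕ Fin 8 → J → K := Sum.elim (Sum.elim ![aL 0, aL 1] ![aL 2, aL 3]) aE
  let v : (Fin 2 ⊕ Fin 2) ⊕ Fin 8 → J → K := Sum.elim (Sum.elim ![vL 0, vL 1] ![vL 2, vL 3]) vE
  refine Summit.ValiantsHypothesis.ValiantsHypothesis.Theorems.SymPencilPerFourInnerRankPureGramKernel.false_of_kernel_functionals
    (S := (Fin 2 ⊕ Fin 2) ⊕ Fin 8) (by simp) hι c u a v ?_ ?_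
  · intro z hz s
    rcases s with (s | s) | s <;> fin_cases s <;>
      simp only [a, Sum.elim_inl, Sum.elim_inr, Matrix.cons_val_zero, Matrix.cons_val_one,
        Matrix.head_cons] <;>
      first
      | exact hkillL z hz _
      | exact hkillE z hz _
  · apply det_ne_zero_of_blocks
    · intro i i'
      rcases i with i | i <;> fin_cases i <;>
        simp only [Matrix.of_apply, a, v, Sum.elim_inl, Sum.elim_inr, Matrix.cons_val_zero,
          Matrix.cons_val_one, Matrix.head_cons] <;>
        exact hLE _ _
    · apply det_ne_zero_of_blocks
      · intro i i'
        fin_cases i <;> fin_cases i' <;>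
          simp only [Matrix.toBlocks₁₁, Matrix.of_apply, a, v, Sum.elim_inl, Sum.elim_inr,
            Matrix.cons_val_zero, Matrix.cons_val_one, Matrix.head_cons] <;>
          first
          | exact h02
          | exact h03
          | exact h12
          | exact h13
      · rw [Matrix.det_fin_two]
        simp only [Matrix.toBlocks₁₁, Matrix.of_apply, a, v, Sum.elim_inl, Sum.elim_inr,
          Matrix.cons_val_zero, Matrix.cons_val_one, Matrix.head_cons, h00, h01, h10, h11]
        norm_num
      · rw [Matrix.det_fin_two]
        simp only [Matrix.toBlocks₁₁, Matrix.toBlocks₂₂, Matrix.of_apply, a, v, Sum.elim_inl,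
          Sum.elim_inr, Matrix.cons_val_zero, Matrix.cons_val_one, Matrix.head_cons]
        exact hD
    · have h1 : (Matrix.of fun s s' : (Fin 2 ⊕ Fin 2) ⊕ Fin 8 => ∑ j, a s j * v s' j).toBlocks₂₂ = 1 := by
        ext i i'
        simp only [Matrix.toBlocks₂₂, Matrix.of_apply, a, v, Sum.elim_inr, Matrix.one_apply]
        exact hEE i i'
      rw [h1, Matrix.det_one]
      exact one_ne_zero


end Summit.ValiantsHypothesis.ValiantsHypothesis.Theorems.SymPencilPerFourInnerRankPureGramLineTools

end
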